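/-
Copyright (c) 2026 the pub-hodgecm-mathlib formalisation cell (harness21).  Prover seat hodgecm-mathlib-LH4-p13 (g2), req620 Track A «(D-RAM) FOUR-FRAME» squad
(heir LEAD F0P3a-plan lineage; dealer LH4-plan lineage; MS ROAD A, Stage B brick B4₂ «SPLIT STRATA, TYPE 2» (the B9 twin of B4; MEMO v2.1 §T2.2), FILE 1: tools).  2026-09-04.
-/
import Summits.HodgeConjecture.HodgeConjecture.Theorems.F0P3cDyRamDiagonalStratumTools   -- ★ B4 FILE 1 p855860 (this seat); brings ★ TorusDefs, ★ `UnitaryLatticeTreeDual`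
import HarnessLib

/-!
# Crux `H413`, MS ROAD A, STAGE B brick B4₂ «SPLIT STRATA, TYPE 2», FILE 1: THREE `ϖ`-MODULAR GRAM BLOCKS — the type-2 vertex certificates of the on-branch strata of ODD depth

Cell `hodgecm-mathlib` (D-0151), FLOOR 0, crux item H413 = `stmt-HodgeConjecture-24833`, route of record `HCCMUnconditional`; squad F0∕P3c∕LH4 (req618∕req620).  THEOREMS ONLY
(no `def`, no instance, no notation, no `sorry`, default heartbeats); lane `--supports stmt-HodgeConjecture-24833 --as helper` (count-neutral).  Road target: tree
`Cruxes/H413/Lines/F0_P3c_DyRamFourFrame_U3_Laws.lean` stub `stub_U3_stableModelSum` (MS), type-2 half (B10₂ skeleton `B10-StableCountTypeTwo.SKELETON.v1` 08e5e6e2d02c47d3 of LH4-p10 (g2)):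
`Σ_{M ∈ 𝓛₀(T), type-2 polarisable} 1∕[𝒰 : S_F(M)] = [k]_q`; the on-branch strata `Tᵢ(s)` contribute `q^{(s−1)∕2}` for ODD `s` (MEMO v2.1 §T2.2) — this is the type-2 twin of ★ B4.

WHAT IS PROVED (generic valued field `K`, `N = 3`).  A lattice `latt g` whose Gram matrix `(σg)ᵀHg` has one of the block shapes `(0 a 0; b c 0; 0 0 e)`, `(e 0 0; 0 0 a; 0 b c)`,
`(0 0 a; 0 e 0; b 0 c)` with `|a| = |b| = |ϖ|`, `|c| ≤ |ϖ|`, `|e| = 1` is a TYPE-2 vertex lattice for `H`: the matrix is integral, `det = −abe` has valuation `|ϖ|²`, and `ϖ·G⁻¹` is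
integral (explicit inverse `(−c∕ab, 1∕b, 0; 1∕a, 0, 0; 0, 0, 1∕e)` etc., whose entries have valuation `≤ |ϖ|⁻¹`).  These are the Gram shapes of `M₃(s,x)`, `M₁(s,z)`, `M₂(s,y)` at odd `s` for
the forms of MEMO v2.1 §T2.2 (`D = (−N(x)π₀^{−j}, π₀^{−j}, 1)`, `s = 2j+1`, etc.); the type-0 twins (unit `a, b`) are ★ `F0P3cDyRamDiagonalStratumTools` §5.
HONEST LABEL.  Count-neutral (`--supports`); nothing printed is asserted; (MS) and the census laws stay PROVER TARGETS until the Stage B bricks and B10∕B10₂ land; `HC_CM` is proved only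
modulo the 7 printed citations (2 remaining named inputs: hLiu418 = `stmt-HodgeConjecture-24832`, h413 = `stmt-HodgeConjecture-24833`) until rung 0 closes.

## References
* [Jacobowitz1962] R. Jacobowitz, *Hermitian forms over local fields*, Amer. J. Math. 84 (1962), §7–§8 (`𝔭`-modular hermitian lattices and their Gram matrices).
* [Rogawski1990] J. D. Rogawski, *Automorphic Representations of Unitary Groups in Three Variables*, Ann. of Math. Stud. 123 (1990), §4.9 Prop. 4.9.1 (a) p. 55.
* [Kottwitz1986BaseChangeUnits] R. E. Kottwitz, *Base change for unit elements of Hecke algebras*, Compositio Math. 60 (1986), §1 pp. 240–241.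
-/

set_option autoImplicit false

noncomputable section

namespace Summit.HodgeConjecture.HodgeConjecture.Cruxes.H413.F0P3cDyRamDiagonalSplitCountTwoTools

open Matrix
open Literature.NumberTheory.Automorphic Literature.NumberTheory.Automorphic.HermitianLattice
open Literature.NumberTheory.Automorphic.UnitaryLatticeTree
open scoped Valued WithZero Matrix MatrixGroups

variable {K : Type*} [Field K] [Valued K ℤᵐ⁰]

/-- A type-2 vertex certificate from a Gram matrix of the block shape `(0 a 0; b c 0; 0 0 e)` with `|a| = |b| = |ϖ|`, `|c| ≤ |ϖ|`, `|e| = 1` — the Gram shape of the AXIS-3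
stratum at odd depth. [cite: Jacobowitz1962, §7–§8] -/
theorem isVertexLattice_two_of_gram_eq_block₃ {σ : K →+* K} {ϖ : K} (hϖ0 : ϖ ≠ 0) (hϖ1 : Valued.v ϖ ≤ 1) {H : Matrix (Fin 3) (Fin 3) K}
    (g : GL (Fin 3) K) {a b c e : K} (hG : formCongr σ g H = !![0, a, 0; b, c, 0; 0, 0, e])
    (ha : Valued.v a = Valued.v ϖ) (hb : Valued.v b = Valued.v ϖ) (hc : Valued.v c ≤ Valued.v ϖ) (he : Valued.v e = 1) :
    IsVertexLattice σ ϖ H 2 (latt (g : Matrix (Fin 3) (Fin 3) K)) := by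
  have hvϖ0 : Valued.v ϖ ≠ 0 := (Valuation.ne_zero_iff _).2 hϖ0
  have ha0 : a ≠ 0 := fun h => by rw [h, map_zero] at ha; exact hvϖ0 ha.symm
  have hb0 : b ≠ 0 := fun h => by rw [h, map_zero] at hb; exact hvϖ0 hb.symm
  have he0 : e ≠ 0 := fun h => by rw [h, map_zero] at he; exact zero_ne_one he
  have hinv : (!![0, a, 0; b, c, 0; 0, 0, e] : Matrix (Fin 3) (Fin 3) K)⁻¹ = !![-c / (a * b), b⁻¹, 0; a⁻¹, 0, 0; 0, 0, e⁻¹] := by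
    refine Matrix.inv_eq_right_inv ?_
    ext i j
    fin_cases i <;> fin_cases j <;> simp [Matrix.mul_apply, Fin.sum_univ_three]
    · exact mul_inv_cancel₀ ha0
    · field_simp
      ring
    · exact mul_inv_cancel₀ hb0
    · exact mul_inv_cancel₀ he0
  refine ⟨g, rfl, ?_, ?_, ?_⟩
  · rw [hG]; intro i j
    fin_cases i <;> fin_cases j <;> simp [ha, hb, hϖ1, hc.trans hϖ1, he.le]
  · -- `|ϖ·c∕(ab)| = |c|∕|ϖ| ≤ 1`, `|ϖ∕a| = |ϖ∕b| = 1`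
    have hA : Valued.v ϖ * (Valued.v c / (Valued.v ϖ * Valued.v ϖ)) ≤ 1 := by
      rw [show Valued.v ϖ * (Valued.v c / (Valued.v ϖ * Valued.v ϖ)) = Valued.v c / Valued.v ϖ by field_simp]
      exact (div_le_one₀ (zero_lt_iff.2 hvϖ0)).2 hc
    rw [hG, hinv]; intro i j
    fin_cases i <;> fin_cases j <;> simp [Matrix.smul_apply, map_mul, map_div₀, map_inv₀, ha, hb, he, hϖ1, hA, hvϖ0]
  · rw [hG, Matrix.det_fin_three]
    simp [map_mul, ha, hb, he, pow_two]

/-- The same for the block shape `(e 0 0; 0 0 a; 0 b c)` — the Gram shape of the AXIS-1 stratum at odd depth. [cite: Jacobowitz1962, §7–§8] -/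
theorem isVertexLattice_two_of_gram_eq_block₁ {σ : K →+* K} {ϖ : K} (hϖ0 : ϖ ≠ 0) (hϖ1 : Valued.v ϖ ≤ 1) {H : Matrix (Fin 3) (Fin 3) K}
    (g : GL (Fin 3) K) {a b c e : K} (hG : formCongr σ g H = !![e, 0, 0; 0, 0, a; 0, b, c])
    (ha : Valued.v a = Valued.v ϖ) (hb : Valued.v b = Valued.v ϖ) (hc : Valued.v c ≤ Valued.v ϖ) (he : Valued.v e = 1) :
    IsVertexLattice σ ϖ H 2 (latt (g : Matrix (Fin 3) (Fin 3) K)) := by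
  have hvϖ0 : Valued.v ϖ ≠ 0 := (Valuation.ne_zero_iff _).2 hϖ0
  have ha0 : a ≠ 0 := fun h => by rw [h, map_zero] at ha; exact hvϖ0 ha.symm
  have hb0 : b ≠ 0 := fun h => by rw [h, map_zero] at hb; exact hvϖ0 hb.symm
  have he0 : e ≠ 0 := fun h => by rw [h, map_zero] at he; exact zero_ne_one he
  have hinv : (!![e, 0, 0; 0, 0, a; 0, b, c] : Matrix (Fin 3) (Fin 3) K)⁻¹ = !![e⁻¹, 0, 0; 0, -c / (a * b), b⁻¹; 0, a⁻¹, 0] := by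
    refine Matrix.inv_eq_right_inv ?_
    ext i j
    fin_cases i <;> fin_cases j <;> simp [Matrix.mul_apply, Fin.sum_univ_three]
    · exact mul_inv_cancel₀ he0
    · exact mul_inv_cancel₀ ha0
    · field_simp
      ring
    · exact mul_inv_cancel₀ hb0
  refine ⟨g, rfl, ?_, ?_, ?_⟩
  · rw [hG]; intro i j
    fin_cases i <;> fin_cases j <;> simp [ha, hb, hϖ1, hc.trans hϖ1, he.le]
  · -- `|ϖ·c∕(ab)| = |c|∕|ϖ| ≤ 1`, `|ϖ∕a| = |ϖ∕b| = 1`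
    have hA : Valued.v ϖ * (Valued.v c / (Valued.v ϖ * Valued.v ϖ)) ≤ 1 := by
      rw [show Valued.v ϖ * (Valued.v c / (Valued.v ϖ * Valued.v ϖ)) = Valued.v c / Valued.v ϖ by field_simp]
      exact (div_le_one₀ (zero_lt_iff.2 hvϖ0)).2 hc
    rw [hG, hinv]; intro i j
    fin_cases i <;> fin_cases j <;> simp [Matrix.smul_apply, map_mul, map_div₀, map_inv₀, ha, hb, he, hϖ1, hA, hvϖ0]
  · rw [hG, Matrix.det_fin_three]
    simp [map_mul, ha, hb, he, pow_two]

/-- The same for the block shape `(0 0 a; 0 e 0; b 0 c)` — the Gram shape of the AXIS-2 stratum at odd depth. [cite: Jacobowitz1962, §7–§8] -/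
theorem isVertexLattice_two_of_gram_eq_block₂ {σ : K →+* K} {ϖ : K} (hϖ0 : ϖ ≠ 0) (hϖ1 : Valued.v ϖ ≤ 1) {H : Matrix (Fin 3) (Fin 3) K}
    (g : GL (Fin 3) K) {a b c e : K} (hG : formCongr σ g H = !![0, 0, a; 0, e, 0; b, 0, c])
    (ha : Valued.v a = Valued.v ϖ) (hb : Valued.v b = Valued.v ϖ) (hc : Valued.v c ≤ Valued.v ϖ) (he : Valued.v e = 1) :
    IsVertexLattice σ ϖ H 2 (latt (g : Matrix (Fin 3) (Fin 3) K)) := by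
  have hvϖ0 : Valued.v ϖ ≠ 0 := (Valuation.ne_zero_iff _).2 hϖ0
  have ha0 : a ≠ 0 := fun h => by rw [h, map_zero] at ha; exact hvϖ0 ha.symm
  have hb0 : b ≠ 0 := fun h => by rw [h, map_zero] at hb; exact hvϖ0 hb.symm
  have he0 : e ≠ 0 := fun h => by rw [h, map_zero] at he; exact zero_ne_one he
  have hinv : (!![0, 0, a; 0, e, 0; b, 0, c] : Matrix (Fin 3) (Fin 3) K)⁻¹ = !![-c / (a * b), 0, b⁻¹; 0, e⁻¹, 0; a⁻¹, 0, 0] := by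
    refine Matrix.inv_eq_right_inv ?_
    ext i j
    fin_cases i <;> fin_cases j <;> simp [Matrix.mul_apply, Fin.sum_univ_three]
    · exact mul_inv_cancel₀ ha0
    · exact mul_inv_cancel₀ he0
    · field_simp
      ring
    · exact mul_inv_cancel₀ hb0
  refine ⟨g, rfl, ?_, ?_, ?_⟩
  · rw [hG]; intro i j
    fin_cases i <;> fin_cases j <;> simp [ha, hb, hϖ1, hc.trans hϖ1, he.le]
  · -- `|ϖ·c∕(ab)| = |c|∕|ϖ| ≤ 1`, `|ϖ∕a| = |ϖ∕b| = 1`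
    have hA : Valued.v ϖ * (Valued.v c / (Valued.v ϖ * Valued.v ϖ)) ≤ 1 := by
      rw [show Valued.v ϖ * (Valued.v c / (Valued.v ϖ * Valued.v ϖ)) = Valued.v c / Valued.v ϖ by field_simp]
      exact (div_le_one₀ (zero_lt_iff.2 hvϖ0)).2 hc
    rw [hG, hinv]; intro i j
    fin_cases i <;> fin_cases j <;> simp [Matrix.smul_apply, map_mul, map_div₀, map_inv₀, ha, hb, he, hϖ1, hA, hvϖ0]
  · rw [hG, Matrix.det_fin_three]
    simp [map_mul, ha, hb, he, pow_two]

end Summit.HodgeConjecture.HodgeConjecture.Cruxes.H413.F0P3cDyRamDiagonalSplitCountTwoTools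

end
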